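import Literature.Probability.Percolation.TrapTermFenceT
import Literature.Probability.Percolation.TrapTermFenceUpT
import HarnessLib

/-!
# The two exterior chains of a fenced exit

Topic `Literature/Probability/Percolation`; family `crit-perc` / near-critical percolation on `𝕋`.
A brick of the near-critical arm-separation theorem for four arms in the ADJACENT colour
arrangement (P. Nolin, EJP 13 (2008), Thm. 11, `j = 4`, `σ = BBWW` [arXiv 0711.4948: Thm. 10]):
the landing step for two arms of the SAME colour. A fenced exit (a stopped term fence with a tall
vertical crossing through its end point `m`, tip `z = (2M, t)`, scale `k ≥ 2`) offers two
vertex-disjoint open structures outside `Λ_{2M}`, both in the rows `> t` (resp. `< t` for a term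
explored from above), which the corridors of the landing catch through FIXED boxes:

* `TermFence.exists_topleft_crossing` — the connection `F` of the fence, from the side to `m`,
  crosses the box `TOPLEFT = [2M + 1, 2M + k - 1] × (t, t + 2k + 1]` horizontally (chain `α`);
* `TermFenceT.exists_midlow_chain` — the lower part of the tall crossing, an open set `B`
  star-shaped from `m` inside `[2M + k, 2M + 2k] × [t + 1, t + 2k]`, crosses the box
  `MIDLOW = [2M + k, 2M + 2k] × [t + 1, t + k - 1]` vertically (chain `β`);
* the mirrors `TermFenceUp.exists_botleft_crossing`, `TermFenceUpT.exists_midhigh_chain`.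

Everything here is proved; no named facts are introduced.

## References

* P. Nolin, Near-critical percolation in two dimensions, *Electron. J. Probab.* 13 (2008), §4.3
  Prop. 12 and §4.4 (arXiv 0711.4948: Prop. 11; proof of Thm. 10) [Nolin2008].
* H. Kesten, *Percolation theory for mathematicians* (1982), §2.2 [KestenPTM1982].
-/

noncomputable section

open Set

namespace Literature.Probability.Percolation

open LatticeModels

/-- `x₀ ≤ |x|_𝕋`. [folklore] -/
theorem apply_zero_le_triNorm (x : Site 2) : x 0 ≤ triNorm x := by
  rw [triNorm_eq_max]; simp only [le_max_iff]; exact Or.inl (Or.inl le_rfl)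

namespace TermFence

variable {M k : ℕ} {c : Finset (Site 2)} {z : Site 2} {ω : SiteConfig (Site 2)} {S : Set (Site 2)}
  (T : TermFence M c z k ω S)

/-- The fence site lies in the columns `[z₀ + k, z₀ + 2k]` and the rows `[z₁ + k, z₁ + 2k]`. [folklore] -/
theorem m_box : z 0 + k ≤ T.m 0 ∧ T.m 0 ≤ z 0 + 2 * k ∧ z 1 + k ≤ T.m 1 ∧ T.m 1 ≤ z 1 + 2 * k := by
  obtain ⟨e₁, e₂, -, -, hp, -⟩ := T.vcross
  have hm := (hp.right_mem).1
  rw [mem_triStrip] at hm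
  omega

/-- **Chain `α`: the connection crosses `TOPLEFT` horizontally.** For a tip `z ∈ trapO M`
(`z₀ = 2M`), `k ≥ 2` and an attachment site of norm `≤ 2M`, the connection `F` contains a path
from the column `2M + 1` to the column `2M + k - 1` inside the columns `[2M + 1, 2M + k - 1]`, and
its sites in these columns have rows in `(z₁, z₁ + 2k + 1]`. [cite: KestenPTM1982, §2.2] -/
theorem exists_topleft_crossing (hk : 2 ≤ k) (hz : z ∈ trapO M) (hq : triNorm T.q ≤ 2 * M) :
    (∃ a b : Site 2, a 0 = z 0 + 1 ∧ b 0 = z 0 + ((k - 1 : ℕ) : ℤ) ∧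
      PathIn triGraph (T.F ∩ {v | z 0 + 1 ≤ v 0 ∧ v 0 ≤ z 0 + ((k - 1 : ℕ) : ℤ)}) a b) ∧
      ∀ v ∈ T.F, z 0 + 1 ≤ v 0 → z 1 < v 1 ∧ v 1 ≤ z 1 + (2 * k + 1) := by
  have hz' := trapO_coord hz
  have hk1 : ((k - 1 : ℕ) : ℤ) = (k : ℤ) - 1 := by omega
  refine ⟨?_, fun v hv hv0 => ?_⟩
  · have hp0 : T.p 0 ≤ z 0 + 1 := by
      have h1 := (triGraph_adj_coord T.adj 0).2
      have h2 := apply_zero_le_triNorm T.q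
      omega
    have hm0 : z 0 + ((k - 1 : ℕ) : ℤ) ≤ T.m 0 := by have := T.m_box; omega
    obtain ⟨a, b, ha, hb, hpath⟩ := T.path.exists_slab_crossing 0 (L := z 0 + 1) (R := z 0 + ((k - 1 : ℕ) : ℤ))
      (by omega) hp0 hm0
    exact ⟨a, b, ha, hb, hpath⟩
  · have hvn : 2 * (M : ℤ) < triNorm v := by have := apply_zero_le_triNorm v; omega
    exact ⟨mem_fenceSet_outside (T.F_subset hv) hvn, (fenceSet_box (T.F_subset hv)).2.2.2⟩

end TermFence

namespace TermFenceT

variable {M k : ℕ} {c : Finset (Site 2)} {z : Site 2} {ω : SiteConfig (Site 2)} {S : Set (Site 2)}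
  (T : TermFenceT M c z k ω S)

/-- **Chain `β`: the lower part of the tall crossing.** An open set `B` inside the tall box
`[z₀ + k, z₀ + 2k] × [z₁ + 1, z₁ + 2k]`, containing `m`, star-shaped from `m`, with a vertical
crossing of the rows `[z₁ + 1, z₁ + k - 1]` (`k ≥ 2`). [cite: KestenPTM1982, §2.2] -/
theorem exists_midlow_chain (hk : 2 ≤ k) :
    ∃ B : Set (Site 2), B ⊆ triStrip (z 0 + k) (z 1 + 1) k (2 * k - 1) ∩ ω ∧ T.m ∈ B ∧ (∀ x ∈ B, PathIn triGraph B T.m x) ∧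
      ∃ a b : Site 2, a 1 = z 1 + ((k - 1 : ℕ) : ℤ) ∧ b 1 = z 1 + 1 ∧
        PathIn triGraph (B ∩ {v | z 1 + 1 ≤ v 1 ∧ v 1 ≤ z 1 + ((k - 1 : ℕ) : ℤ)}) a b := by
  obtain ⟨bb, tt, hbb, -, hPb, -⟩ := T.vtall
  obtain ⟨B, hB, hP, hT⟩ := hPb.symm.exists_support
  have hk1 : ((k - 1 : ℕ) : ℤ) = (k : ℤ) - 1 := by omega
  have hm1 : z 1 + ((k - 1 : ℕ) : ℤ) ≤ T.m 1 := by have := T.toTermFence.m_box; omega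
  obtain ⟨a, b, ha, hb, hpath⟩ := hP.exists_slab_crossing' 1 (L := z 1 + 1) (R := z 1 + ((k - 1 : ℕ) : ℤ))
    (by omega) hm1 (by rw [hbb])
  exact ⟨B, hB, hP.left_mem, hT, a, b, ha, hb, hpath⟩

end TermFenceT

namespace TermFenceUp

variable {M k : ℕ} {d : Finset (Site 2)} {z : Site 2} {ω : SiteConfig (Site 2)} {S : Set (Site 2)}
  (T : TermFenceUp M d z k ω S)

/-- The fence site of a fence from above lies in `[z₀ + k, z₀ + 2k] × [z₁ - 2k, z₁ - k]`. [folklore] -/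
theorem m_box : z 0 + k ≤ T.m 0 ∧ T.m 0 ≤ z 0 + 2 * k ∧ z 1 - 2 * k ≤ T.m 1 ∧ T.m 1 ≤ z 1 - k := by
  obtain ⟨e₁, e₂, -, -, hp, -⟩ := T.vcross
  have hm := (hp.right_mem).1
  rw [mem_triStrip] at hm
  omega

/-- **Chain `α` from above: the connection crosses `BOTLEFT = [2M + 1, 2M + k - 1] × [z₁ - 2k - 1, z₁)`
horizontally** (mirror of `TermFence.exists_topleft_crossing`). [cite: KestenPTM1982, §2.2] -/
theorem exists_botleft_crossing (hk : 2 ≤ k) (hz : z ∈ trapO M) (hq : triNorm T.q ≤ 2 * M) :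
    (∃ a b : Site 2, a 0 = z 0 + 1 ∧ b 0 = z 0 + ((k - 1 : ℕ) : ℤ) ∧
      PathIn triGraph (T.F ∩ {v | z 0 + 1 ≤ v 0 ∧ v 0 ≤ z 0 + ((k - 1 : ℕ) : ℤ)}) a b) ∧
      ∀ v ∈ T.F, z 0 + 1 ≤ v 0 → v 1 < z 1 ∧ z 1 - (2 * k + 1) ≤ v 1 := by
  have hz' := trapO_coord hz
  have hk1 : ((k - 1 : ℕ) : ℤ) = (k : ℤ) - 1 := by omega
  refine ⟨?_, fun v hv hv0 => ?_⟩
  · have hp0 : T.p 0 ≤ z 0 + 1 := by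
      have h1 := (triGraph_adj_coord T.adj 0).2
      have h2 := apply_zero_le_triNorm T.q
      omega
    have hm0 : z 0 + ((k - 1 : ℕ) : ℤ) ≤ T.m 0 := by have := T.m_box; omega
    obtain ⟨a, b, ha, hb, hpath⟩ := T.path.exists_slab_crossing 0 (L := z 0 + 1) (R := z 0 + ((k - 1 : ℕ) : ℤ))
      (by omega) hp0 hm0
    exact ⟨a, b, ha, hb, hpath⟩
  · have hvn : 2 * (M : ℤ) < triNorm v := by have := apply_zero_le_triNorm v; omega
    exact ⟨mem_fenceSetUp_outside (T.F_subset hv) hvn, (fenceSetUp_box (T.F_subset hv)).2.2.1⟩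

end TermFenceUp

namespace TermFenceUpT

variable {M k : ℕ} {d : Finset (Site 2)} {z : Site 2} {ω : SiteConfig (Site 2)} {S : Set (Site 2)}
  (T : TermFenceUpT M d z k ω S)

/-- **Chain `β` from above: the upper part of the tall crossing**, an open set `B` inside
`[z₀ + k, z₀ + 2k] × [z₁ - 2k, z₁ - 1]`, containing `m`, star-shaped from `m`, with a vertical
crossing of the rows `[z₁ - k + 1, z₁ - 1]` (`k ≥ 2`). [cite: KestenPTM1982, §2.2] -/
theorem exists_midhigh_chain (hk : 2 ≤ k) :
    ∃ B : Set (Site 2), B ⊆ triStrip (z 0 + k) (z 1 - 2 * k) k (2 * k - 1) ∩ ω ∧ T.m ∈ B ∧ (∀ x ∈ B, PathIn triGraph B T.m x) ∧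
      ∃ a b : Site 2, a 1 = z 1 - ((k - 1 : ℕ) : ℤ) ∧ b 1 = z 1 - 1 ∧
        PathIn triGraph (B ∩ {v | z 1 - ((k - 1 : ℕ) : ℤ) ≤ v 1 ∧ v 1 ≤ z 1 - 1}) a b := by
  obtain ⟨bb, tt, -, htt, -, hPt⟩ := T.vtall
  obtain ⟨B, hB, hP, hT⟩ := hPt.exists_support
  have hk1 : ((k - 1 : ℕ) : ℤ) = (k : ℤ) - 1 := by omega
  have hm1 : T.m 1 ≤ z 1 - ((k - 1 : ℕ) : ℤ) := by have := T.toTermFenceUp.m_box; omega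
  obtain ⟨a, b, ha, hb, hpath⟩ := hP.exists_slab_crossing 1 (L := z 1 - ((k - 1 : ℕ) : ℤ)) (R := z 1 - 1)
    (by omega) hm1 (by rw [htt])
  exact ⟨B, hB, hP.left_mem, hT, a, b, ha, hb, hpath⟩

end TermFenceUpT

end Literature.Probability.Percolation
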